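import Mathlib
import Literature.Geometry.Manifold.CompactSupportFlow

/-!
# Base motion of a closed 4-manifold with prescribed initial velocity

Stub `stub_baseMotion` of the crux `InformationMetricHadamard.AhHadamardFilling`
(line `einstein-bulk-transfer`): given finitely many smooth vector fields `Y i` on a closed
4-manifold `M`, scalars `c i : M → ℝ` and `C¹` functions `V i : M × ℝ → ℝ`, smooth off `λ = 0`,
vanishing on `λ = 0` with `dV_i (x,0) (v,s) = s c_i x`, the composite of the global flows
`θ_i` of the `Y i` (compactly supported fields are complete,
`Literature.Geometry.Manifold.exists_contMDiff_globalFlow_of_eq_zero_off_isCompact`) for times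
`V_i (x, λ)` is a `C¹` family `F : M × ℝ → M`, smooth off `λ = 0`, with `F (x, 0) = x` and
`dF_{(x,0)} (v, s) = v + s • ∑ i, c i x • Y i x`.  Induction on the number of fields; the
derivative at `λ = 0` is the chain rule plus the splitting of `dθ_{(0,x)}` into the velocity of
the integral curve and the identity (`mfderiv_prod_eq_add_apply`).
-/

noncomputable section

set_option linter.dupNamespace false

open scoped Manifold ContDiff Topology
open Set Function Bundle

namespace Summit.SmoothPoincare4.SmoothPoincare4.Cruxes.AhHadamardFilling.EinsteinBulkTransfer

/-- **One step of the base motion.** If `G : M × ℝ → M` is `C¹`, smooth off `λ = 0`, with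
`G (x, 0) = x` and `dG_{(x,0)} (v, s) = v + s • Z x`, and `θ` is the global flow of a smooth
field `Y₀` on the closed manifold `M`, then `F (x, λ) := θ (V₀ (x, λ), G (x, λ))` has the same
properties with `Z` replaced by `Z + c₀ • Y₀`, where `dV₀_{(x,0)} (v, s) = s c₀ x`. -/
theorem baseMotion_step
    {M : Type} [TopologicalSpace M] [T2Space M]
    [ChartedSpace (EuclideanSpace ℝ (Fin 4)) M] [IsManifold (𝓡 4) ∞ M] [CompactSpace M]
    {Y₀ : (x : M) → TangentSpace (𝓡 4) x}
    (hY₀ : ContMDiff (𝓡 4) (𝓡 4).tangent ∞ (fun x => (⟨x, Y₀ x⟩ : TangentBundle (𝓡 4) M)))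
    {c₀ : M → ℝ} {V₀ : M × ℝ → ℝ}
    (hV1 : ContMDiff ((𝓡 4).prod 𝓘(ℝ, ℝ)) 𝓘(ℝ, ℝ) 1 V₀)
    (hV : ContMDiffOn ((𝓡 4).prod 𝓘(ℝ, ℝ)) 𝓘(ℝ, ℝ) ∞ V₀ (univ ×ˢ {0}ᶜ))
    (hV0 : ∀ x : M, V₀ (x, 0) = 0)
    (hVd : ∀ (x : M) (v : TangentSpace (𝓡 4) x) (s : ℝ),
      mfderiv ((𝓡 4).prod 𝓘(ℝ, ℝ)) 𝓘(ℝ, ℝ) V₀ (x, 0) (v, s) = s * c₀ x)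
    {G : M × ℝ → M} {Z : (x : M) → TangentSpace (𝓡 4) x}
    (hG1 : ContMDiff ((𝓡 4).prod 𝓘(ℝ, ℝ)) (𝓡 4) 1 G)
    (hG : ContMDiffOn ((𝓡 4).prod 𝓘(ℝ, ℝ)) (𝓡 4) ∞ G (univ ×ˢ {0}ᶜ))
    (hG0 : ∀ x : M, G (x, 0) = x)
    (hGd : ∀ (x : M) (v : TangentSpace (𝓡 4) x) (s : ℝ),
      mfderiv ((𝓡 4).prod 𝓘(ℝ, ℝ)) (𝓡 4) G (x, 0) (v, s) = v + s • Z x) :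
    ∃ F : M × ℝ → M, ContMDiff ((𝓡 4).prod 𝓘(ℝ, ℝ)) (𝓡 4) 1 F ∧
      ContMDiffOn ((𝓡 4).prod 𝓘(ℝ, ℝ)) (𝓡 4) ∞ F (univ ×ˢ {0}ᶜ) ∧
      (∀ x : M, F (x, 0) = x) ∧
      ∀ (x : M) (v : TangentSpace (𝓡 4) x) (s : ℝ),
        mfderiv ((𝓡 4).prod 𝓘(ℝ, ℝ)) (𝓡 4) F (x, 0) (v, s) =
          v + s • (Z x + c₀ x • Y₀ x) := by
  obtain ⟨θ, hθ, hθ0, -, hθint, -⟩ :=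
    Literature.Geometry.Manifold.exists_contMDiff_globalFlow_of_eq_zero_off_isCompact
      (I := 𝓡 4) (n := (⊤ : ℕ∞)) hY₀ le_top isCompact_univ
      (fun x hx => absurd (mem_univ x) hx)
  have hθ1 : ContMDiff (𝓘(ℝ, ℝ).prod (𝓡 4)) (𝓡 4) 1 θ := hθ.of_le (by exact_mod_cast le_top)
  refine ⟨fun p => θ (V₀ p, G p), hθ1.comp (hV1.prodMk hG1),
    hθ.comp_contMDiffOn (hV.prodMk hG), fun x => ?_, fun x v s => ?_⟩
  · simp only [hV0, hG0, hθ0]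
  · have hdV : MDifferentiableAt ((𝓡 4).prod 𝓘(ℝ, ℝ)) 𝓘(ℝ, ℝ) V₀ (x, 0) :=
      hV1.mdifferentiableAt one_ne_zero
    have hdG : MDifferentiableAt ((𝓡 4).prod 𝓘(ℝ, ℝ)) (𝓡 4) G (x, 0) :=
      hG1.mdifferentiableAt one_ne_zero
    have hdθ : MDifferentiableAt (𝓘(ℝ, ℝ).prod (𝓡 4)) (𝓡 4) θ ((0 : ℝ), x) :=
      hθ1.mdifferentiableAt one_ne_zero
    have hfx : (fun p : M × ℝ => (V₀ p, G p)) (x, 0) = ((0 : ℝ), x) := by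
      simp only [hV0, hG0]
    have hcomp : (fun p : M × ℝ => θ (V₀ p, G p)) = θ ∘ fun p => (V₀ p, G p) := rfl
    rw [hcomp, mfderiv_comp_apply_of_eq _ hdθ (hdV.prodMk hdG) hfx, mfderiv_prodMk hdV hdG]
    change mfderiv (𝓘(ℝ, ℝ).prod (𝓡 4)) (𝓡 4) θ ((0 : ℝ), x)
      (mfderiv ((𝓡 4).prod 𝓘(ℝ, ℝ)) 𝓘(ℝ, ℝ) V₀ (x, 0) (v, s),
        mfderiv ((𝓡 4).prod 𝓘(ℝ, ℝ)) (𝓡 4) G (x, 0) (v, s)) = _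
    rw [hVd, hGd, mfderiv_prod_eq_add_apply hdθ]
    -- the curve `t ↦ θ (t, x)` is an integral curve of `Y₀` through `x`
    have hcurve : ∀ a : ℝ,
        mfderiv 𝓘(ℝ, ℝ) (𝓡 4) (fun t : ℝ => θ (t, x)) 0 a = a • Y₀ x := by
      intro a
      have h : mfderiv 𝓘(ℝ, ℝ) (𝓡 4) (fun t : ℝ => θ (t, x)) 0 =
          (1 : ℝ →L[ℝ] ℝ).smulRight (Y₀ (θ (0, x))) := (hθint x 0).mfderiv
      rw [h, hθ0 x]
      rfl
    -- the time-`0` map is the identity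
    have hslice : ∀ w : TangentSpace (𝓡 4) x,
        mfderiv (𝓡 4) (𝓡 4) (fun q : M => θ (0, q)) x w = w := by
      intro w
      rw [show (fun q : M => θ (0, q)) = id from funext hθ0, mfderiv_id]
      rfl
    dsimp only
    rw [hcurve, hslice, smul_add, smul_smul]
    abel

/-- **Base motion with prescribed initial velocity.** On a closed 4-manifold `M`, given smooth
vector fields `Y i`, scalars `c i` and `C¹` functions `V i : M × ℝ → ℝ` (smooth off `λ = 0`,
`V i (x, 0) = 0`, `dV_i (x,0) (v, s) = s c_i x`), there is a `C¹` family `F : M × ℝ → M`, smooth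
off `λ = 0`, with `F (x, 0) = x` and `dF_{(x,0)} (v, s) = v + s • ∑ i, c i x • Y i x`: compose
the global flows of the `Y i` (compactly supported fields on the compact boundaryless `M` are
complete) at times `V i (x, λ)`. -/
theorem stub_baseMotion
    (M : Type) [TopologicalSpace M] [T2Space M] [SecondCountableTopology M]
    [ChartedSpace (EuclideanSpace ℝ (Fin 4)) M] [IsManifold (𝓡 4) ∞ M] [CompactSpace M]
    (m : ℕ) (Y : Fin m → (x : M) → TangentSpace (𝓡 4) x)
    (hY : ∀ i, ContMDiff (𝓡 4) (𝓡 4).tangent ∞ (fun x => (⟨x, Y i x⟩ : TangentBundle (𝓡 4) M)))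
    (c : Fin m → M → ℝ) (V : Fin m → M × ℝ → ℝ)
    (hV1 : ∀ i, ContMDiff ((𝓡 4).prod 𝓘(ℝ, ℝ)) 𝓘(ℝ, ℝ) 1 (V i))
    (hV : ∀ i, ContMDiffOn ((𝓡 4).prod 𝓘(ℝ, ℝ)) 𝓘(ℝ, ℝ) ∞ (V i) (univ ×ˢ {0}ᶜ))
    (hV0 : ∀ i (x : M), V i (x, 0) = 0)
    (hVd : ∀ i (x : M) (v : TangentSpace (𝓡 4) x) (s : ℝ),
      mfderiv ((𝓡 4).prod 𝓘(ℝ, ℝ)) 𝓘(ℝ, ℝ) (V i) (x, 0) (v, s) = s * c i x) :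
    ∃ F : M × ℝ → M, ContMDiff ((𝓡 4).prod 𝓘(ℝ, ℝ)) (𝓡 4) 1 F ∧
      ContMDiffOn ((𝓡 4).prod 𝓘(ℝ, ℝ)) (𝓡 4) ∞ F (univ ×ˢ {0}ᶜ) ∧
      (∀ x : M, F (x, 0) = x) ∧
      ∀ (x : M) (v : TangentSpace (𝓡 4) x) (s : ℝ),
        mfderiv ((𝓡 4).prod 𝓘(ℝ, ℝ)) (𝓡 4) F (x, 0) (v, s) = v + s • ∑ i, c i x • Y i x := by
  induction m with
  | zero =>
    refine ⟨Prod.fst, contMDiff_fst, contMDiffOn_fst, fun x => rfl, fun x v s => ?_⟩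
    rw [mfderiv_fst, Finset.univ_eq_empty, Finset.sum_empty, smul_zero, add_zero]
    rfl
  | succ m ih =>
    obtain ⟨G, hG1, hG, hG0, hGd⟩ := ih (fun i => Y i.castSucc) (fun i => hY i.castSucc)
      (fun i => c i.castSucc) (fun i => V i.castSucc) (fun i => hV1 i.castSucc)
      (fun i => hV i.castSucc) (fun i => hV0 i.castSucc) (fun i => hVd i.castSucc)
    obtain ⟨F, hF1, hF, hF0, hFd⟩ := baseMotion_step (hY (Fin.last m)) (hV1 (Fin.last m))
      (hV (Fin.last m)) (hV0 (Fin.last m)) (hVd (Fin.last m)) hG1 hG hG0 hGd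
    refine ⟨F, hF1, hF, hF0, fun x v s => ?_⟩
    rw [hFd, Fin.sum_univ_castSucc]

end Summit.SmoothPoincare4.SmoothPoincare4.Cruxes.AhHadamardFilling.EinsteinBulkTransfer

end
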